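import Summits.BirchSwinnertonDyer.BirchSwinnertonDyer.Theorems.SchneiderFreeAdditiveX3AnticycControlAdditiveOfTorsAtoms
import Literature.NumberTheory.EllipticCurves.IwasawaSelmerControlKernelCardProofs
import HarnessLib

/-!
# Crux `AnticycControlAdditive` (route `SchneiderFreeAdditiveX3`, item stmt-BirchSwinnertonDyer-19178):
# the exponent `g` of the torsion-robust count IS `ord_p #E(K)[p^∞]`

Seat `bsd-schneider-door-c4` (cell `bsd-schneider-ideate`). Companion of
`…AnticycControlAdditiveTorsionCount.lean` / `…OfTorsAtoms.lean`, where the kernel of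
`res : H¹(K, E[p^∞]) → H¹(K_∞, E[p^∞])` (tree `resOfLe le_top` on `H¹(⊤, E[p^∞])`) enters the
control count as `#ker res = p^g`. Here (KER-res) is IDENTIFIED on tree objects: if
`B = E(K_∞)[p^∞] = E[p^∞]^{Gal(K̄/K_∞)}` is finite, then `#ker res = #E(K)[p^∞]`
(`= #E[p^∞]^{Γ_K}`), by the tree's Greenberg Lemma 3.1/4.3 computation
`natCard_ker_layerToInfty_eq_natCard_fixedPoints` at layer `n = 0`, transported along
`H¹(⊤, ·) ≅ H¹(κ⁻¹(p⁰ℤ_p), ·)` (`⊤ = Gal(K̄/K₀)`). So the atom (P6-add-tors) of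
`additiveControlOnTreeAt_of_torsAtoms` reads, as in the derivation memo (evidence on the item),
`a = ord_p #Ш + 2(ord_p log_ω P − ord_p idx) + ord_p ∏_{w∣p} c_w + ord_p #E(K)[p^∞] − t`,
`p^t = #ker r_𝔭`. The finiteness of `E(K_∞^{ac})[p^∞]` is a hypothesis here (standard: reduce at a
prime of `K` inert in `K/ℚ`, which splits completely in `K_∞^{ac}`), not a tree theorem. Proofs
only; nothing asserted; closes nothing by itself.

References: [GreenbergLNM1716] §3 Lemma 3.1 (p. 86), §4 Lemma 4.3 (p. 103).
-/

noncomputable section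

open scoped Classical

open WeierstrassCurve NumberField IsDedekindDomain Field Literature.NumberTheory.EllipticCurves
  Literature.NumberTheory.EllipticCurves.GreenbergSelmer
  Literature.NumberTheory.GaloisRepresentations
  Summit.BirchSwinnertonDyer.Rank1Residual.X11b
  Summit.BirchSwinnertonDyer.Rank1Residual.X11b.AcSelmer

set_option linter.dupNamespace false

namespace Summit.BirchSwinnertonDyer.BirchSwinnertonDyer.Theorems.SchneiderFreeAdditiveX3

section ResKernel

variable {K : Type} [Field K] [NumberField K] (W : WeierstrassCurve K) [W.IsElliptic] (p : ℕ)
  [Fact p.Prime] (κ : ZpExtension K p)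

omit [NumberField K] [W.IsElliptic] in
/-- `H¹(⊤, E[p^∞]) → H¹(κ⁻¹(p⁰ℤ_p), E[p^∞])`, restriction along `κ⁻¹(p⁰ℤ_p) ≤ ⊤` — an isomorphism
(the two subgroups coincide, `top_le_layerSubgroup_zero`), with inverse the restriction along
`⊤ ≤ κ⁻¹(p⁰ℤ_p)`. [folklore] -/
theorem resOfLe_layerZero_comp :
    (W.resOfLe p (le_top : κ.layerSubgroup 0 ≤ ⊤)).comp
        (W.resOfLe p (top_le_layerSubgroup_zero κ)) = AddMonoidHom.id _ := by
  rw [WeierstrassCurve.resOfLe, WeierstrassCurve.resOfLe,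
      Literature.NumberTheory.EllipticCurves.resOfLe_comp_holds]
  exact resOfLe_refl_holds _

omit [NumberField K] [W.IsElliptic] in
/-- … and the other composite is the identity too. [folklore] -/
theorem resOfLe_top_comp_layerZero :
    (W.resOfLe p (top_le_layerSubgroup_zero κ)).comp
        (W.resOfLe p (le_top : κ.layerSubgroup 0 ≤ ⊤)) = AddMonoidHom.id _ := by
  rw [WeierstrassCurve.resOfLe, WeierstrassCurve.resOfLe,
      Literature.NumberTheory.EllipticCurves.resOfLe_comp_holds]
  exact resOfLe_refl_holds _

omit [W.IsElliptic] in
/-- **(KER-res) identified: `#ker(H¹(K, E[p^∞]) → H¹(K_∞, E[p^∞])) = #E(K)[p^∞]`** when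
`E(K_∞)[p^∞] = E[p^∞]^{ker κ}` is finite (Greenberg, LNM 1716, proof of Lemma 4.3: "`ker(h) =
H¹(Γ, E(F_∞)_p)` has the same order as `H⁰(Γ, E(F_∞)_p) = E(F)_p`"; tree
`natCard_ker_layerToInfty_eq_natCard_fixedPoints` at `n = 0`). Hence the exponent `g` of
`additiveControlOnTreeAt_of_torsAtoms` is `ord_p #E(K)[p^∞]` (the GLOBAL `p`-torsion exponent,
`≤ t_p`). [cite: GreenbergLNM1716, §4 Lemma 4.3 (p. 103)] -/
theorem natCard_ker_resOfLe_top_eq_natCard_fixedPoints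
    [Finite (FixedPoints.addSubgroup κ.kerSubgroup (geomPrimaryTorsion W p))] :
    Nat.card (W.resOfLe p (le_top : κ.kerSubgroup ≤ ⊤)).ker =
      Nat.card {m : geomPrimaryTorsion W p | ∀ σ : absoluteGaloisGroup K, σ • m = m} := by
  -- `ker(H¹(⊤, E[p^∞]) → H¹(K_∞, E[p^∞])) ≃ ker h₀`, `h₀ = layerToInfty κ 0`, by transport along
  -- `H¹(⊤) ≅ H¹(κ⁻¹(p⁰ℤ_p))`
  let e : (W.resOfLe p (le_top : κ.kerSubgroup ≤ ⊤)).ker ≃ (W.layerToInfty κ 0).ker :=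
    { toFun := fun c ↦ ⟨W.resOfLe p (le_top : κ.layerSubgroup 0 ≤ ⊤) c.1, by
        have hc : W.resOfLe p (le_top : κ.kerSubgroup ≤ ⊤) c.1 = 0 :=
          (AddMonoidHom.mem_ker).mp c.2
        rw [AddMonoidHom.mem_ker, WeierstrassCurve.layerToInfty, ← AddMonoidHom.comp_apply,
          WeierstrassCurve.resOfLe, WeierstrassCurve.resOfLe,
          Literature.NumberTheory.EllipticCurves.resOfLe_comp_holds]
        exact hc⟩
      invFun := fun d ↦ ⟨W.resOfLe p (top_le_layerSubgroup_zero κ) d.1, by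
        have hd : W.layerToInfty κ 0 d.1 = 0 := (AddMonoidHom.mem_ker).mp d.2
        rw [AddMonoidHom.mem_ker, ← AddMonoidHom.comp_apply, WeierstrassCurve.resOfLe,
          WeierstrassCurve.resOfLe, Literature.NumberTheory.EllipticCurves.resOfLe_comp_holds]
        exact hd⟩
      left_inv := fun c ↦ by
        apply Subtype.ext
        show W.resOfLe p (top_le_layerSubgroup_zero κ)
          (W.resOfLe p (le_top : κ.layerSubgroup 0 ≤ ⊤) c.1) = c
        rw [← AddMonoidHom.comp_apply, resOfLe_top_comp_layerZero, AddMonoidHom.id_apply]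
      right_inv := fun d ↦ by
        apply Subtype.ext
        show W.resOfLe p (le_top : κ.layerSubgroup 0 ≤ ⊤)
          (W.resOfLe p (top_le_layerSubgroup_zero κ) d.1) = d
        rw [← AddMonoidHom.comp_apply, resOfLe_layerZero_comp, AddMonoidHom.id_apply] }
  rw [Nat.card_congr e, W.natCard_ker_layerToInfty_eq_natCard_fixedPoints κ 0]
  refine Nat.card_congr (Equiv.subtypeEquivRight fun m ↦ ⟨fun h σ ↦ h σ ?_, fun h σ _ ↦ h σ⟩)
  exact top_le_layerSubgroup_zero κ (Subgroup.mem_top σ)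

end ResKernel

end Summit.BirchSwinnertonDyer.BirchSwinnertonDyer.Theorems.SchneiderFreeAdditiveX3

end
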